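import Mathlib.AlgebraicGeometry.Morphisms.ClosedImmersion
import Mathlib.AlgebraicGeometry.IdealSheaf.Functorial
import Mathlib.CategoryTheory.MorphismProperty.Limits
import Mathlib.RingTheory.TensorProduct.Quotient
import Literature.AlgebraicGeometry.Motives.CrystallineRealization
import Literature.AlgebraicGeometry.Deformation.SquareZeroExtensionObstruction
import HarnessLib

/-!
# The transition map `X_{n+1} ⟶ X_{n+2}` of the `p`-adic tower is a first-order thickening

For a prime `p`, a field `k` of characteristic `p`, `W = W(k)`, `W_m = W/p^m`, and a `W`-scheme
`𝒳` with thickenings `X_m = 𝒳 ×_W Spec W_m`, the transition map `X_{n+1} ⟶ X_{n+2}` is a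
first-order thickening in the sense of
`Literature.AlgebraicGeometry.Deformation.IsFirstOrderThickening` (Stacks Tag 08KY): a closed
immersion whose kernel ideal sheaf `𝓘` satisfies `𝓘 · 𝓘 = 0`.

Proof. `X_{n+1} ⟶ X_{n+2}` is the base change along `X_{n+2} ⟶ Spec W_{n+2}` of
`Spec W_{n+1} ⟶ Spec W_{n+2}` (pullback pasting), i.e. of `Spec` of the surjection
`W_{n+2} → W_{n+1}` whose kernel `p^{n+1}W_{n+2}` has square zero. We prove in general
(`ker_mul_ker_eq_bot_of_isPullback`, `isFirstOrderThickening_of_isPullback`): the base change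
`i : Z ⟶ Y` of `Spec (R ↠ R')` with `(ker)² = 0` along any `Y ⟶ Spec R` is a first-order
thickening. The closed-immersion half is Mathlib's stability under base change; for the kernel,
`Scheme.IdealSheafData` are compared on affine opens `V = Spec A ⊆ Y`
(`Scheme.ker_ideal_of_isPullback_of_isOpenImmersion` along `IsAffineOpen.fromSpec`), where the base
change is `Spec (A ⊗_R R') ⟶ Spec A` (`pullbackSpecIso`) with ring kernel
`ker(R → R') · A` (`Algebra.TensorProduct.quotIdealMapEquivTensorQuot`), of square zero.

This is stub G1 (`stub_thickeningMap_firstOrder`) of line `sigma-ob-kzero-additivity` of the crux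
`PadicPridhamSemiregularity` (route `PadicSemiregularLift` of `HodgeConjecture`): pure tower
geometry, valid for every `W(k)`-scheme (no smoothness or flatness needed).

Provenance: Literature home (family `hodge`, layer `Literature/AlgebraicGeometry/FormalGeometry`, namespace
`Literature.AlgebraicGeometry.FormalGeometry.WittGrothendieckExistence…`) of the Summits-side
`Theorems/PadicSemiregularLiftPadicPridhamSemiregularityThickeningMapFirstOrder` (route `PadicSemiregularLift` / `AnchorTransport`,
Grothendieck existence for vector bundles over `W(k)`), which `Literature/` may not import; theorems only, no
named fact, no definition. Lane `lit-hodgefound`, seat p20.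
-/

noncomputable section

open CategoryTheory CategoryTheory.Limits _root_.AlgebraicGeometry TensorProduct
  Literature.AlgebraicGeometry.Motives Literature.AlgebraicGeometry.Motives.WittScheme
  Literature.AlgebraicGeometry.Deformation

universe u

namespace Literature.AlgebraicGeometry.FormalGeometry.WittGrothendieckExistence.PadicPridhamSemiregularity

/-! ### Ring-level facts -/

/-- For `R → R'` surjective with kernel `K` and any `R`-algebra `A`, the kernel of
`A → A ⊗_R R'` is `K·A` (`A ⊗_R R/K ≅ A/KA`, Mathlib `quotIdealMapEquivTensorQuot`).
[cite: GortzWedhorn2023, Def. 24.85 (p. 561) and proof of Thm. 24.94 (pp. 566–567), auxiliary step] -/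
theorem ker_algebraMap_tensorProduct_of_surjective {R A R' : Type*} [CommRing R] [CommRing A]
    [CommRing R'] [Algebra R A] [Algebra R R'] (hφ : Function.Surjective (algebraMap R R')) :
    RingHom.ker (algebraMap A (A ⊗[R] R')) =
      (RingHom.ker (algebraMap R R')).map (algebraMap R A) := by
  have hφ' : Function.Surjective (Algebra.ofId R R') := hφ
  have hKeq : RingHom.ker (Algebra.ofId R R') = RingHom.ker (algebraMap R R') := rfl
  let e₁ : (R ⧸ RingHom.ker (algebraMap R R')) ≃ₐ[R] R' :=
    (Ideal.quotientEquivAlgOfEq R hKeq).symm.trans (Ideal.quotientKerAlgEquivOfSurjective hφ')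
  let e : (A ⧸ (RingHom.ker (algebraMap R R')).map (algebraMap R A)) ≃ₐ[A] A ⊗[R] R' :=
    (Algebra.TensorProduct.quotIdealMapEquivTensorQuot A (RingHom.ker (algebraMap R R'))).trans
      (Algebra.TensorProduct.congr (AlgEquiv.refl : A ≃ₐ[A] A) e₁)
  have he : algebraMap A (A ⊗[R] R') =
      (e : (A ⧸ (RingHom.ker (algebraMap R R')).map (algebraMap R A)) →+* A ⊗[R] R').comp
        (algebraMap A (A ⧸ (RingHom.ker (algebraMap R R')).map (algebraMap R A))) := by
    ext a
    simp only [RingHom.coe_comp, RingHom.coe_coe, Function.comp_apply, AlgEquiv.commutes]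
  rw [he, RingHom.ker_comp_of_injective _ e.injective, Ideal.Quotient.algebraMap_eq,
    Ideal.mk_ker]

/-- Transfer of "square zero": if `g : A → B` is injective, `J · J = 0` in `B`, and `g(I) ⊆ J`,
then `I · I = 0`. [cite: GortzWedhorn2023, Def. 24.85 (p. 561) and proof of Thm. 24.94 (pp. 566–567), auxiliary step] -/
theorem ideal_mul_self_eq_bot_of_injective {A B : Type*} [CommRing A] [CommRing B]
    (g : A →+* B) (hg : Function.Injective g) {I : Ideal A} {J : Ideal B} (hJ : J * J = ⊥)
    (h : ∀ x ∈ I, g x ∈ J) : I * I = ⊥ := by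
  refine le_bot_iff.mp (Ideal.mul_le.mpr fun x hx y hy => ?_)
  rw [Ideal.mem_bot]
  apply hg
  rw [map_mul, map_zero]
  have hxy := Ideal.mul_mem_mul (h x hx) (h y hy)
  rwa [hJ, Ideal.mem_bot] at hxy

/-- The kernel of `W_{n} = R/𝔞ⁿ → R/𝔞ᵐ = W_m` has square zero as soon as `n ≤ 2m`
(it is `𝔞ᵐ/𝔞ⁿ`). [cite: GortzWedhorn2023, Def. 24.85 (p. 561) and proof of Thm. 24.94 (pp. 566–567), auxiliary step] -/
theorem ker_factor_mul_self_eq_bot {R : Type*} [CommRing R] (𝔞 : Ideal R) {m n : ℕ}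
    (h : m ≤ n) (h2 : n ≤ m + m) :
    RingHom.ker (Ideal.Quotient.factor (Ideal.pow_le_pow_right h : 𝔞 ^ n ≤ 𝔞 ^ m)) *
      RingHom.ker (Ideal.Quotient.factor (Ideal.pow_le_pow_right h : 𝔞 ^ n ≤ 𝔞 ^ m)) =
        ⊥ := by
  refine le_bot_iff.mp (Ideal.mul_le.mpr fun x hx y hy => ?_)
  obtain ⟨a, rfl⟩ := Ideal.Quotient.mk_surjective x
  obtain ⟨b, rfl⟩ := Ideal.Quotient.mk_surjective y
  rw [RingHom.mem_ker, Ideal.Quotient.factor_mk, Ideal.Quotient.eq_zero_iff_mem] at hx hy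
  rw [Ideal.mem_bot, ← map_mul, Ideal.Quotient.eq_zero_iff_mem]
  exact Ideal.pow_le_pow_right h2 (by rw [pow_add]; exact Ideal.mul_mem_mul hx hy)

/-! ### Base change of `Spec (R ↠ R')` with square-zero kernel -/

/-- Affine model: for `R → R'` surjective with square-zero kernel and any `R → A`, the kernel
ideal sheaf of `Spec A ×_{Spec R} Spec R' ⟶ Spec A` has square zero (it is `Spec (A ⊗_R R') →
Spec A`, Mathlib `pullbackSpecIso`, with ring kernel `ker(R → R')·A`). [cite: GortzWedhorn2023, Def. 24.85 (p. 561) and proof of Thm. 24.94 (pp. 566–567), auxiliary step] -/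
theorem ker_pullbackFst_mul_self_eq_bot {R A R' : Type u} [CommRing R] [CommRing A]
    [CommRing R'] (φ : R →+* R') (ψ : R →+* A) (hφ : Function.Surjective φ)
    (hK : RingHom.ker φ * RingHom.ker φ = ⊥) :
    (pullback.fst (Spec.map (CommRingCat.ofHom ψ)) (Spec.map (CommRingCat.ofHom φ))).ker *
      (pullback.fst (Spec.map (CommRingCat.ofHom ψ)) (Spec.map (CommRingCat.ofHom φ))).ker =
        ⊥ := by
  letI := φ.toAlgebra
  letI := ψ.toAlgebra
  change (pullback.fst (Spec.map (CommRingCat.ofHom (algebraMap R A)))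
      (Spec.map (CommRingCat.ofHom (algebraMap R R')))).ker *
    (pullback.fst (Spec.map (CommRingCat.ofHom (algebraMap R A)))
      (Spec.map (CommRingCat.ofHom (algebraMap R R')))).ker = ⊥
  rw [← pullbackSpecIso_hom_fst', Scheme.Hom.ker_comp_of_isIso, Scheme.ker_of_isAffine]
  set f := Spec.map (CommRingCat.ofHom (algebraMap A (A ⊗[R] R'))) with hf
  -- the ring-level kernel has square zero
  have hJ : RingHom.ker (algebraMap A (A ⊗[R] R')) *
      RingHom.ker (algebraMap A (A ⊗[R] R')) = ⊥ := by
    rw [ker_algebraMap_tensorProduct_of_surjective (A := A) hφ, ← Ideal.map_mul]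
    change (RingHom.ker φ * RingHom.ker φ).map _ = ⊥
    rw [hK, Ideal.map_bot]
  -- transfer to `Γ(Spec A, ⊤)` along `ΓSpecIso`
  have hK' : RingHom.ker f.appTop.hom * RingHom.ker f.appTop.hom = ⊥ := by
    refine ideal_mul_self_eq_bot_of_injective (Scheme.ΓSpecIso (.of A)).hom.hom
      (Scheme.ΓSpecIso (.of A)).commRingCatIsoToRingEquiv.injective hJ fun x hx => ?_
    have nat := congrArg (fun g => g.hom x)
      (Scheme.ΓSpecIso_naturality (CommRingCat.ofHom (algebraMap A (A ⊗[R] R'))))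
    simp only [CommRingCat.hom_comp, RingHom.comp_apply, CommRingCat.hom_ofHom] at nat
    rw [RingHom.mem_ker] at hx ⊢
    rw [← nat, ← hf, hx, map_zero]
  refine Scheme.IdealSheafData.ext_of_isAffine ?_
  simp only [Scheme.IdealSheafData.ideal_mul, Pi.mul_apply, Scheme.IdealSheafData.ideal_bot,
    Pi.bot_apply, Scheme.IdealSheafData.ofIdealTop_ideal, ← Ideal.map_mul, hK', Ideal.map_bot]

/-- Transfer along an open immersion `g : X' ⟶ Y`: if the base change `i' = X' ×_Y Z ⟶ X'` of a
quasi-compact `i : Z ⟶ Y` has kernel of square zero on an affine open `W ⊆ X'`, then so does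
`i` on `g(W)` (Mathlib `Scheme.ker_ideal_of_isPullback_of_isOpenImmersion`). [cite: GortzWedhorn2023, Def. 24.85 (p. 561) and proof of Thm. 24.94 (pp. 566–567), auxiliary step] -/
theorem ker_ideal_mul_self_eq_bot_of_isOpenImmersion {X' Y Z : Scheme.{u}} (i : Z ⟶ Y)
    [QuasiCompact i] (g : X' ⟶ Y) [IsOpenImmersion g] (W : X'.affineOpens)
    (h : (pullback.snd i g).ker.ideal W * (pullback.snd i g).ker.ideal W = ⊥) :
    i.ker.ideal ⟨g ''ᵁ W, W.2.image_of_isOpenImmersion g⟩ *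
      i.ker.ideal ⟨g ''ᵁ W, W.2.image_of_isOpenImmersion g⟩ = ⊥ := by
  have HV : IsPullback (pullback.snd i g) (pullback.fst i g) g i :=
    (IsPullback.of_hasPullback i g).flip
  have hker := Scheme.ker_ideal_of_isPullback_of_isOpenImmersion i (pullback.snd i g)
    (pullback.fst i g) g HV W
  rw [hker] at h
  refine ideal_mul_self_eq_bot_of_injective (g.appIso W).hom.hom
    (g.appIso W).commRingCatIsoToRingEquiv.injective h fun x hx => ?_
  simpa [Ideal.mem_comap] using hx

/-- **Base change of a square-zero surjection has square-zero kernel.** Let `φ : R → R'` be a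
surjective ring map with `ker φ · ker φ = 0`, and let `i : Z ⟶ Y` be a base change of
`Spec φ : Spec R' ⟶ Spec R` along some `q : Y ⟶ Spec R`. Then `Ker(i♯) · Ker(i♯) = 0` in
`Y.IdealSheafData`. (Checked on affine opens `V = Spec A` of `Y`, where `i` restricts to
`Spec (A ⊗_R R') ⟶ Spec A`.) [cite: GortzWedhorn2023, Def. 24.85 (p. 561) and proof of Thm. 24.94 (pp. 566–567), auxiliary step] -/
theorem ker_mul_ker_eq_bot_of_isPullback {R R' : Type u} [CommRing R] [CommRing R']
    {φ : R →+* R'} (hφ : Function.Surjective φ) (hK : RingHom.ker φ * RingHom.ker φ = ⊥)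
    {Y Z : Scheme.{u}} {i : Z ⟶ Y} {q' : Z ⟶ Spec (.of R')} {q : Y ⟶ Spec (.of R)}
    (H : IsPullback i q' q (Spec.map (CommRingCat.ofHom φ))) : i.ker * i.ker = ⊥ := by
  haveI : IsClosedImmersion i :=
    MorphismProperty.of_isPullback H.flip (IsClosedImmersion.spec_of_surjective _ hφ)
  ext V : 2
  simp only [Scheme.IdealSheafData.ideal_mul, Pi.mul_apply, Scheme.IdealSheafData.ideal_bot,
    Pi.bot_apply]
  obtain ⟨V, hV⟩ := V
  -- the open immersion `Spec Γ(Y, V) ⟶ Y` and the base change of `i` along it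
  let g : Spec Γ(Y, V) ⟶ Y := hV.fromSpec
  have HV : IsPullback (pullback.snd i g) (pullback.fst i g) g i :=
    (IsPullback.of_hasPullback i g).flip
  -- `g ≫ q = Spec ψ`
  let ψ : CommRingCat.of R ⟶ Γ(Y, V) :=
    (Scheme.ΓSpecIso (.of R)).inv ≫ q.appLE ⊤ V (fun _ _ => trivial)
  have hgq : g ≫ q = Spec.map ψ := by
    simp only [ψ, g, Spec.map_comp, ← Scheme.isoSpec_Spec_inv, ← IsAffineOpen.fromSpec_top]
    exact (IsAffineOpen.SpecMap_appLE_fromSpec q (isAffineOpen_top _) hV _).symm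
  have HV' : IsPullback (pullback.snd i g) (pullback.fst i g ≫ q')
      (Spec.map (CommRingCat.ofHom ψ.hom)) (Spec.map (CommRingCat.ofHom φ)) := by
    rw [CommRingCat.ofHom_hom, ← hgq]
    exact HV.paste_vert H
  -- on `Spec Γ(Y, V)` the kernel is that of the affine model
  have hD := ker_pullbackFst_mul_self_eq_bot φ ψ.hom hφ hK
  rw [← Scheme.Hom.ker_comp_of_isIso HV'.isoPullback.hom, HV'.isoPullback_hom_fst] at hD
  have hW := congrArg (fun I : Scheme.IdealSheafData _ => I.ideal ⟨⊤, isAffineOpen_top _⟩) hD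
  simp only [Scheme.IdealSheafData.ideal_mul, Pi.mul_apply, Scheme.IdealSheafData.ideal_bot,
    Pi.bot_apply] at hW
  have h' := ker_ideal_mul_self_eq_bot_of_isOpenImmersion i g ⟨⊤, isAffineOpen_top _⟩ hW
  have heq : (⟨g ''ᵁ (⊤ : (Spec Γ(Y, V)).Opens),
      (isAffineOpen_top _).image_of_isOpenImmersion g⟩ : Y.affineOpens) = ⟨V, hV⟩ :=
    Subtype.ext (by simp [g, Scheme.Hom.image_top_eq_opensRange])
  rwa [heq] at h'

/-- **First-order thickenings by base change.** With `φ`, `i` as in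
`ker_mul_ker_eq_bot_of_isPullback`, `i` is a first-order thickening: a closed immersion (base
change of the closed immersion `Spec φ`, Mathlib) with square-zero kernel ideal sheaf.
(Stacks Tag 08KY; base change of thickenings, cf. Tag 04EX.) [cite: GortzWedhorn2023, Def. 24.85 (p. 561) and proof of Thm. 24.94 (pp. 566–567), auxiliary step] -/
theorem isFirstOrderThickening_of_isPullback {R R' : Type u} [CommRing R] [CommRing R']
    {φ : R →+* R'} (hφ : Function.Surjective φ) (hK : RingHom.ker φ * RingHom.ker φ = ⊥)
    {Y Z : Scheme.{u}} {i : Z ⟶ Y} {q' : Z ⟶ Spec (.of R')} {q : Y ⟶ Spec (.of R)}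
    (H : IsPullback i q' q (Spec.map (CommRingCat.ofHom φ))) : IsFirstOrderThickening i :=
  haveI : IsClosedImmersion i :=
    MorphismProperty.of_isPullback H.flip (IsClosedImmersion.spec_of_surjective _ hφ)
  { ker_mul_ker_eq_bot := ker_mul_ker_eq_bot_of_isPullback hφ hK H }

/-! ### The `p`-adic tower -/

/-- Pullback pasting: for `t : S₁ ⟶ S₂` over `S` (`t ≫ s₂ = s₁`) and `f : X ⟶ S`, the
induced map `X ×_S S₁ ⟶ X ×_S S₂` is the base change of `t` along `X ×_S S₂ ⟶ S₂`
(`X ×_S S₁ = (X ×_S S₂) ×_{S₂} S₁`). [cite: GortzWedhorn2023, Def. 24.85 (p. 561) and proof of Thm. 24.94 (pp. 566–567), auxiliary step] -/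
theorem isPullback_pullbackMap_snd {C : Type*} [Category C] [HasPullbacks C]
    {X S S₁ S₂ : C} (f : X ⟶ S) (s₁ : S₁ ⟶ S) (s₂ : S₂ ⟶ S) (t : S₁ ⟶ S₂)
    (ht : t ≫ s₂ = s₁) :
    IsPullback
      (pullback.map f s₁ f s₂ (𝟙 X) t (𝟙 S) (by rw [Category.comp_id, Category.id_comp])
        (by rw [Category.comp_id, ht]))
      (pullback.snd f s₁) (pullback.snd f s₂) t := by
  subst ht
  refine (IsPullback.of_bot ?_ (pullback.lift_snd _ _ _).symm
    (IsPullback.of_hasPullback f s₂).flip).flip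
  rw [pullback.lift_fst, Category.comp_id]
  exact (IsPullback.of_hasPullback _ _).flip

/-- The transition map `X_m ⟶ X_n` (`m ≤ n`) of the tower of a `W(k)`-scheme `𝒳` is the base
change of `Spec W_m ⟶ Spec W_n` along the structure map `X_n ⟶ Spec W_n` (pullback pasting:
`X_m = 𝒳 ×_W W_m = X_n ×_{W_n} W_m`). [cite: GortzWedhorn2023, Def. 24.85 (p. 561) and proof of Thm. 24.94 (pp. 566–567), auxiliary step] -/
theorem isPullback_thickeningMap {p : ℕ} [Fact p.Prime] {k : Type u} [CommRing k]
    (𝒳 : SchemeOver (WittVector p k)) {m n : ℕ} (h : m ≤ n) :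
    IsPullback (thickeningMap 𝒳 h) (thickening 𝒳 m).hom (thickening 𝒳 n).hom
      (Spec.map (CommRingCat.ofHom (Ideal.Quotient.factor
        (Ideal.pow_le_pow_right h : Ideal.span {(p : WittVector p k)} ^ n ≤ _)))) :=
  isPullback_pullbackMap_snd 𝒳.hom _ _ _
    (by rw [← Spec.map_comp, ← CommRingCat.ofHom_comp]; rfl)

/-- Stub G1 of line `sigma-ob-kzero-additivity`: for every `W(k)`-scheme `𝒳` and every `n`, the
transition map `X_{n+1} ⟶ X_{n+2}` is a first-order thickening (closed immersion with kernel
`p^{n+1}𝒪_{X_{n+2}}`, whose square `p^{2n+2}𝒪 ⊆ p^{n+2}𝒪 = 0`). Base change of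
`Spec (W_{n+2} ↠ W_{n+1})` (`isPullback_thickeningMap`, `isFirstOrderThickening_of_isPullback`,
`ker_factor_mul_self_eq_bot`). [cite: GortzWedhorn2023, Def. 24.85 (p. 561) and proof of Thm. 24.94 (pp. 566–567), auxiliary step] -/
theorem stub_thickeningMap_firstOrder :
  ∀ (p : ℕ) [Fact p.Prime] (k : Type) [Field k] [CharP k p] (𝒳 : SchemeOver (WittVector p k))
    (n : ℕ), IsFirstOrderThickening (thickeningMap 𝒳 (Nat.le_succ (n + 1))) := by
  intro p _ k _ _ 𝒳 n
  exact isFirstOrderThickening_of_isPullback (Ideal.Quotient.factor_surjective _)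
    (ker_factor_mul_self_eq_bot _ (Nat.le_succ (n + 1)) (by omega))
    (isPullback_thickeningMap 𝒳 (Nat.le_succ (n + 1)))

end Literature.AlgebraicGeometry.FormalGeometry.WittGrothendieckExistence.PadicPridhamSemiregularity

end
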